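import Mathlib.LinearAlgebra.Dimension.Finrank
import Mathlib.LinearAlgebra.FiniteDimensional.Defs
import HarnessLib

/-!
# The local-monodromy datum `∃ V, (T − 1)H ⊆ V, Σ_{i<p} T^i|_V = 0, dim V ≤ m` is invariant under conjugation

Layer `Literature/AlgebraicGeometry/HodgeTheory`; theorems only (no definition, no named fact). Written by the prover seat
`hodge-nonav-prover-Ax` (g10) for the discharge of the cited fact
`HodgeTheory.carlsonToledo1999_nodalMeridianLocalMonodromyBound` (crux K1 of the route
`Summits/HodgeConjecture/HodgeConjecture/Theses/CyclicUnitaryPowers.lean`).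

That fact asserts, for the transport `T` of EVERY meridian of the discriminant centred at a one-nodal branch curve, the datum
`∃ V, (∀ x, T x − x ∈ V) ∧ (∀ v ∈ V, Σ_{i<p} Tⁱ v = 0) ∧ dim V ≤ p − 1` (Carlson–Toledo 1999 §6). The geometric construction
(programme "localisation of the nodal meridian monodromy") produces it for the transport along ONE explicit small circle;
every meridian transport is a CONJUGATE `A⁻¹ ∘ T ∘ A` of that one — by the transport along the leash of the meridian
(`IsRatTransport.trans` / `.symm`) and then by the conjugacy of all meridians of an irreducible hypersurface in `π₁`
(`FundamentalGroup.affineHypersurfaceComplement_meridian_isConj_holds`, Shimada 2010 Prop. 3.4) through the monodromy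
homomorphism. This file records the linear algebra of that transfer:

* `exists_localMonodromyDatum_of_conj` — if `T : W ≃ W` carries the datum with bound `m`, then so does
  `A.trans (T.trans A.symm) : V ≃ V` (`x ↦ A⁻¹(T(A x))`) for every `A : V ≃ W`, with the subspace `A⁻¹(V_T)`;
* `exists_localMonodromyDatum_of_mul_conj` — the same for `g * T * g⁻¹` in `V ≃ₗ V` (group conjugation).

## References

* [CarlsonToledo1999] J. A. Carlson, D. Toledo, Duke Math. J. 97 (1999), §6 (kdoublept) (held text p0013–p0014), §3.
* [Shimada2010ZvK] I. Shimada, Lectures on Zariski–van Kampen theorem, arXiv:0906.1074, §3 Prop. 3.4.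
-/

namespace Literature.AlgebraicGeometry.HodgeTheory

section Conjugate

variable {K : Type*} [Field K] {V W : Type*} [AddCommGroup V] [Module K V] [AddCommGroup W] [Module K W]

/-- Powers of a conjugate: `(A⁻¹ T A)^i x = A⁻¹ (T^i (A x))`. [cite: CarlsonToledo1999, §3 (held text p0006)] -/
theorem conj_pow_apply (T : W ≃ₗ[K] W) (A : V ≃ₗ[K] W) (i : ℕ) (x : V) :
    ((A.trans (T.trans A.symm)) ^ i) x = A.symm ((T ^ i) (A x)) := by
  induction i generalizing x with
  | zero => simp
  | succ i ih =>
    rw [pow_succ, LinearEquiv.mul_apply, ih, pow_succ, LinearEquiv.mul_apply]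
    simp

/-- **The local-monodromy datum passes to conjugates.** If `T : W ≃ W` admits a subspace `V_T` with `T x − x ∈ V_T` for
all `x`, `Σ_{i<p} Tⁱ v = 0` on `V_T` and `dim V_T ≤ m`, then `A⁻¹TA : V ≃ V` (`= A.trans (T.trans A.symm)`) admits
`A⁻¹(V_T)` with the same three properties, for every `A : V ≃ W` (transport along the leash of a meridian, or any
monodromy element). [cite: CarlsonToledo1999, §6 (kdoublept) (held text p0013–p0014)] [cite: Shimada2010ZvK, §3 Prop. 3.4] -/
theorem exists_localMonodromyDatum_of_conj [FiniteDimensional K W] {p m : ℕ} (T : W ≃ₗ[K] W) (A : V ≃ₗ[K] W)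
    (h : ∃ U : Submodule K W, (∀ x, T x - x ∈ U) ∧ (∀ v ∈ U, (∑ i ∈ Finset.range p, (T ^ i) v) = 0) ∧
      Module.finrank K U ≤ m) :
    ∃ U' : Submodule K V, (∀ x, (A.trans (T.trans A.symm)) x - x ∈ U') ∧
      (∀ v ∈ U', (∑ i ∈ Finset.range p, ((A.trans (T.trans A.symm)) ^ i) v) = 0) ∧
      Module.finrank K U' ≤ m := by
  obtain ⟨U, hU₁, hU₂, hU₃⟩ := h
  refine ⟨U.map (A.symm : W →ₗ[K] V), fun x => ?_, fun v hv => ?_, ?_⟩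
  · -- `A⁻¹ T A x − x = A⁻¹ (T (A x) − A x)`
    refine ⟨T (A x) - A x, hU₁ (A x), ?_⟩
    simp [map_sub]
  · obtain ⟨w, hw, rfl⟩ := hv
    have : ∀ i, ((A.trans (T.trans A.symm)) ^ i) ((A.symm : W →ₗ[K] V) w) = A.symm ((T ^ i) w) := fun i => by
      rw [LinearEquiv.coe_coe, conj_pow_apply, LinearEquiv.apply_symm_apply]
    simp_rw [this]
    rw [← map_sum, hU₂ w hw, map_zero]
  · rw [LinearEquiv.finrank_map_eq]
    exact hU₃

/-- **Group-conjugation form**: in `V ≃ₗ V` (where `(g * T) x = g (T x)`), if `T` carries the datum then so does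
`g * T * g⁻¹`, with the subspace `g(V_T)`. [cite: CarlsonToledo1999, §6 (kdoublept) (held text p0013–p0014)]
[cite: Shimada2010ZvK, §3 Prop. 3.4] -/
theorem exists_localMonodromyDatum_of_mul_conj [FiniteDimensional K V] {p m : ℕ} (T g : V ≃ₗ[K] V)
    (h : ∃ U : Submodule K V, (∀ x, T x - x ∈ U) ∧ (∀ v ∈ U, (∑ i ∈ Finset.range p, (T ^ i) v) = 0) ∧
      Module.finrank K U ≤ m) :
    ∃ U' : Submodule K V, (∀ x, (g * T * g⁻¹) x - x ∈ U') ∧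
      (∀ v ∈ U', (∑ i ∈ Finset.range p, ((g * T * g⁻¹) ^ i) v) = 0) ∧
      Module.finrank K U' ≤ m := by
  have heq : g * T * g⁻¹ = g.symm.trans (T.trans g.symm.symm) := by
    apply LinearEquiv.ext
    intro x
    rw [LinearEquiv.mul_apply, LinearEquiv.mul_apply, LinearEquiv.trans_apply, LinearEquiv.trans_apply,
      LinearEquiv.symm_symm]
    rfl
  rw [heq]
  exact exists_localMonodromyDatum_of_conj T g.symm h

end Conjugate

end Literature.AlgebraicGeometry.HodgeTheory
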